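import Summits.QuantumFields.YangMills.Theorems.SmallFieldWideningWideningOfTiltAndMassTVTail
import Summits.QuantumFields.YangMills.Theorems.SmallFieldWideningWideningOfTiltAndMassTVNontrivial

/-!
# Route `SmallFieldWidening` — THE TOTAL-VARIATION WIDENING AS A PATTERN: every `G`, every measurable smearing, ANY chained
# measurable windows, finitely many steps excised, `∀ ε ∃ depth` form (support of item `WideningOfTiltAndMass`,
# stmt-QuantumFields-22885; helper, route-independent)

WHAT THIS IS NOT: not E3, not a crux of the route, not d = 4, not a mass gap, not Clay; no summit is proved.  Hypothesis schemas only.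

WHAT IT IS.  The sibling `…WideningOfTiltAndMassSchema` (gen 6) typed the item's widening as the PATTERN
`hasContinuumLimit_of_refine_unitTilt_uniformMass`: for every `ε > 0` a refinement depth `n`, an excision depth `K₀`, a mass `δ ≤ ε`,
measurable windows `E_K` of the refined family's fine fields and summable radii such that from `K₀` on the unit push-forwards of the
restricted Gibbs measures are CHAINED tilts and the complements' masses are `≤ δ` ⇒ `HasContinuumLimit (F.scheme ℰ γ)` — so that r2 may
be re-typed (interior windows, profile floors, excised steps) without touching the widening.  This file gives the same pattern its
TOTAL-VARIATION conclusion, with the VERBATIM hypothesis of that theorem: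
* §1 (pure measure theory) the excised form of `WideningTV.uniform_abs_integral_sub_le_of_tilt_uniformMass` (index shift).
* §2 (every `G`, measurable `ℰ`, `γ ≥ 0`) one family, any windows, from `K₀` on: `|∫ W d(unitLaw K) − ∫ W d(unitLaw K')| ≤ 6δ + ε`
  uniformly over measurable `|W| ≤ 1` (`unitLaw_uniform_near_of_windowTilt`); THE PATTERN: `∀ ε ∃ depth …` ⇒ the unit laws of the
  ORIGINAL family are UNIFORMLY CAUCHY over measurable `|g| ≤ 1` (`unitLaw_uniformCauchy_of_refine_windowTilt_uniformMass`) — which gives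
  the schema's `HasContinuumLimit` back through `WideningTV.hasContinuumLimit_of_unitLaw_cauchySeq`.
* §3 (`SU(2)`, `ℰp`) under the pattern's hypothesis: the effective densities `Z_J⁻¹ρ̂_J` converge in `L¹(dV_{T₁})`, the unit laws converge in
  total variation to an absolutely continuous probability law (`exists_limitUnitLaw_TV_of_refine_windowTilt_uniformMass`, via
  `WideningTVTail.exists_limitUnitLaw_TV_of_uniformCauchy`), and (NT3) holds for every Haar-atomless label, so `LimitPointsNontrivial`
  (`exists_uniformVariance_of_haarNull_of_pattern`, `limitPointsNontrivial_of_pattern`, via `WideningTVNT.variance_eventually_ge_of_tvLimit`).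
-/

noncomputable section

open MeasureTheory Filter Topology
open scoped ENNReal
open Literature.MathematicalPhysics.QuantumFieldTheory.Balaban1983to89
open Literature.MathematicalPhysics.QuantumFieldTheory.Balaban1983to89.Missing
open Literature.MathematicalPhysics.QuantumFieldTheory.Balaban1983to89.T4Continuum
open Literature.MathematicalPhysics.QuantumFieldTheory.Balaban1983to89.T3ContinuumYM3Torus
open Literature.MathematicalPhysics.QuantumFieldTheory.Balaban1983to89.T3ThresholdRemoval
open Literature.MathematicalPhysics.QuantumFieldTheory.Balaban1983to89.T3UnitLawDensityEML (ℰp measurableE_ℰp)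
open Literature.MathematicalPhysics.QuantumFieldTheory.Balaban1983to89.T3UnitScaleTilt
open Literature.MathematicalPhysics.QuantumFieldTheory.Balaban1983to89.T3ContinuumUnitLaw
open Summit.QuantumFields.YangMills.Theorems.WideningTV
open Summit.QuantumFields.YangMills.Theorems.WideningTVTail
open Summit.QuantumFields.YangMills.Theorems.WideningTVNT

namespace Summit.QuantumFields.YangMills.Theorems.WideningTVWindow

/-! ## §1 Pure measure theory: the excised form of the uniform estimate -/

section Abstract

variable {X : Type*} [MeasurableSpace X]

/-- **UNIFORMLY APPROXIMATELY CAUCHY LAWS, FINITELY MANY STEPS EXCISED**: probability laws `P_K`, split as `μ_K + μ'_K` for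
`K ≥ K₀` with bad masses `≤ δ` and consecutive good parts tilt-related with summable radii from `K₀` on ⇒ for every `ε > 0` ONE index
`K₁` gives `|∫ W dP_K − ∫ W dP_{K'}| ≤ 6δ + ε` for all `K, K' ≥ K₁` and all measurable `|W| ≤ 1` (the landed estimate on the shifted data). -/
theorem uniform_abs_integral_sub_le_of_tilt_uniformMass_from (P μ μ' : ℕ → Measure X) (K₀ : ℕ)
    (hPp : ∀ K, IsProbabilityMeasure (P K)) (hP : ∀ K, K₀ ≤ K → P K = μ K + μ' K) {δ : ℝ}
    (hδ : ∀ K, K₀ ≤ K → (μ' K).real Set.univ ≤ δ) {r : ℕ → ℝ} (hr : Summable r)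
    (ht : ∀ K, K₀ ≤ K → IsTilt (μ K) (μ (K + 1)) (r K)) {ε : ℝ} (hε : 0 < ε) :
    ∃ K₁ : ℕ, ∀ K K' : ℕ, K₁ ≤ K → K₁ ≤ K' → ∀ W : X → ℝ, Measurable W → (∀ x, |W x| ≤ 1) →
      |(∫ x, W x ∂P K) - ∫ x, W x ∂P K'| ≤ 6 * δ + ε := by
  obtain ⟨K₁, hK₁⟩ := uniform_abs_integral_sub_le_of_tilt_uniformMass (fun K => P (K + K₀)) (fun K => μ (K + K₀))
    (fun K => μ' (K + K₀)) (fun K => hPp (K + K₀)) (fun K => hP (K + K₀) (Nat.le_add_left K₀ K))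
    (fun K => hδ (K + K₀) (Nat.le_add_left K₀ K)) ((summable_nat_add_iff K₀).mpr hr)
    (fun K => by
      have e : K + 1 + K₀ = K + K₀ + 1 := Nat.add_right_comm K 1 K₀
      rw [e]
      exact ht (K + K₀) (Nat.le_add_left K₀ K)) hε
  refine ⟨K₁ + K₀, fun K K' hK hK' W hWm hW => ?_⟩
  obtain ⟨i, rfl⟩ := Nat.exists_eq_add_of_le' ((Nat.le_add_left K₀ K₁).trans hK)
  obtain ⟨i', rfl⟩ := Nat.exists_eq_add_of_le' ((Nat.le_add_left K₀ K₁).trans hK')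
  exact hK₁ i i' (Nat.le_of_add_le_add_right hK) (Nat.le_of_add_le_add_right hK') W hWm hW

end Abstract

/-! ## §2 Every `G`, every measurable `ℰ`: any chained windows, excised steps; the pattern in total variation -/

section Pattern

variable (F : T3Family) {G : Type*} [GaugeGroup G] [MeasurableSpace G] [HaarData G] [RegularGaugeGroup G]
  (ℰ : LoopAverage G)

/-- **ONE FAMILY, ANY WINDOWS, FROM `K₀` ON** (every `G`, measurable `ℰ`, `γ ≥ 0`): if from step `K₀` on the unit push-forwards of the
Gibbs measures restricted to measurable windows `E_K`, `E_{K+1}` are chained tilts of summable radii and the Gibbs masses of `E_Kᶜ` are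
`≤ δ`, then for every `ε > 0` ONE index `K₁` gives `|∫ W d(unitLaw K) − ∫ W d(unitLaw K')| ≤ 6δ + ε` for all `K, K' ≥ K₁` and all measurable
`|W| ≤ 1` — the total-variation form of the sibling `exists_cauchySeq_near_integral_unitLaw`. -/
theorem unitLaw_uniform_near_of_windowTilt (hE : ℰ.MeasurableE) {γ : ℝ} (hγ : 0 ≤ γ) (K₀ : ℕ)
    (E : ∀ K, Set (GaugeField (F.P K) 0 G)) (hEm : ∀ K, MeasurableSet (E K)) {δ : ℝ}
    (hmass : ∀ K, K₀ ≤ K → (gibbsK F ℰ γ K).real (E K)ᶜ ≤ δ) {r : ℕ → ℝ} (hr : Summable r)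
    (ht : ∀ K, K₀ ≤ K → IsTilt (Measure.map (unitA F ℰ K) ((gibbsK F ℰ γ K).restrict (E K)))
      (Measure.map (unitA F ℰ (K + 1)) ((gibbsK F ℰ γ (K + 1)).restrict (E (K + 1)))) (r K))
    {ε : ℝ} (hε : 0 < ε) :
    ∃ K₁ : ℕ, ∀ K K' : ℕ, K₁ ≤ K → K₁ ≤ K' → ∀ W : GaugeField (F.P 0) 0 G → ℝ, Measurable W → (∀ u, |W u| ≤ 1) →
      |(∫ u, W u ∂F.unitLaw ℰ hE γ K) - ∫ u, W u ∂F.unitLaw ℰ hE γ K'| ≤ 6 * δ + ε :=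
  uniform_abs_integral_sub_le_of_tilt_uniformMass_from (fun K => F.unitLaw ℰ hE γ K)
    (fun K => Measure.map (unitA F ℰ K) ((gibbsK F ℰ γ K).restrict (E K)))
    (fun K => Measure.map (unitA F ℰ K) ((gibbsK F ℰ γ K).restrict (E K)ᶜ)) K₀
    (fun K => isProbabilityMeasure_unitLaw hE hγ K) (fun K _ => unitLaw_eq_map_restrict_add hE K (hEm K))
    (fun K hK => by rw [real_map_restrict_univ hE]; exact hmass K hK) hr ht hε

/-- **THE TOTAL-VARIATION WIDENING PATTERN, `∀ ε ∃ depth` FORM** (every `G`, every measurable `ℰ`, `γ ≥ 0`; the VERBATIM hypothesis of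
`WideningOfTiltAndMass.hasContinuumLimit_of_refine_unitTilt_uniformMass`): for every `ε > 0` a refinement depth `n`, an excision depth
`K₀`, a mass `δ ≤ ε` (`δ < 1`), measurable windows of the refined family `F.refine n` at `γL^{-n}` and summable radii, chained tilts and
masses `≤ δ` from `K₀` on ⇒ the unit laws `unitLaw F ℰ γ J` of the ORIGINAL family are UNIFORMLY CAUCHY over measurable `|g| ≤ 1`
(§2 at a depth with `6δ ≤ 6(ε/14)`, transported by `unitLaw^{F}_{K+n} = (Π_n)_* unitLaw^{F.refine n}_K`). -/
theorem unitLaw_uniformCauchy_of_refine_windowTilt_uniformMass (hE : ℰ.MeasurableE) {γ : ℝ} (hγ : 0 ≤ γ)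
    (h : ∀ ε : ℝ, 0 < ε → ∃ (n K₀ : ℕ) (δ : ℝ) (E : ∀ K, Set (GaugeField ((F.refine n).P K) 0 G)) (r : ℕ → ℝ),
      δ ≤ ε ∧ δ < 1 ∧ (∀ K, MeasurableSet (E K)) ∧ Summable r ∧
      (∀ K, K₀ ≤ K → IsTilt
        (Measure.map (unitA (F.refine n) ℰ K)
          ((gibbsK (F.refine n) ℰ (γ * ((F.L : ℝ)⁻¹) ^ n) K).restrict (E K)))
        (Measure.map (unitA (F.refine n) ℰ (K + 1))
          ((gibbsK (F.refine n) ℰ (γ * ((F.L : ℝ)⁻¹) ^ n) (K + 1)).restrict (E (K + 1)))) (r K)) ∧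
      (∀ K, K₀ ≤ K → (gibbsK (F.refine n) ℰ (γ * ((F.L : ℝ)⁻¹) ^ n) K).real (E K)ᶜ ≤ δ))
    {ε : ℝ} (hε : 0 < ε) :
    ∃ J₀ : ℕ, ∀ J J' : ℕ, J₀ ≤ J → J₀ ≤ J' → ∀ g : GaugeField (F.P 0) 0 G → ℝ, Measurable g → (∀ u, |g u| ≤ 1) →
      |(∫ u, g u ∂F.unitLaw ℰ hE γ J) - ∫ u, g u ∂F.unitLaw ℰ hE γ J'| ≤ ε := by
  obtain ⟨n, K₀, δ, E, r, hδε, _, hEm, hr, ht, hmass⟩ := h (ε / 14) (by positivity)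
  have hγ' : 0 ≤ γ * ((F.L : ℝ)⁻¹) ^ n := mul_nonneg hγ (pow_nonneg (inv_nonneg.mpr (Nat.cast_nonneg _)) n)
  obtain ⟨K₁, hK₁⟩ := unitLaw_uniform_near_of_windowTilt (F.refine n) ℰ hE hγ' K₀ E hEm hmass hr ht (half_pos hε)
  refine ⟨K₁ + n, fun J J' hJ hJ' g hgm hg1 => ?_⟩
  obtain ⟨K, rfl⟩ := Nat.exists_eq_add_of_le' ((Nat.le_add_left n K₁).trans hJ)
  obtain ⟨K', rfl⟩ := Nat.exists_eq_add_of_le' ((Nat.le_add_left n K₁).trans hJ')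
  have hmc := measurable_coarsen F n ℰ hE (G := G)
  rw [unitLaw_add_eq_map_coarsen F n ℰ hE hγ K, unitLaw_add_eq_map_coarsen F n ℰ hE hγ K',
    integral_map hmc.aemeasurable hgm.aestronglyMeasurable,
    integral_map hmc.aemeasurable hgm.aestronglyMeasurable]
  have h' := hK₁ K K' (Nat.le_of_add_le_add_right hJ) (Nat.le_of_add_le_add_right hJ')
    (fun u => g (coarsen F n ℰ u)) (hgm.comp hmc) (fun u => hg1 _)
  linarith

end Pattern

/-! ## §3 `SU(2)`, printed smearing: the pattern gives the `L¹` limit density, the a.c. limit law, and (NT3) -/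

section PatternSU2

variable (F : T3Family)

/-- **THE PATTERN ⇒ TOTAL-VARIATION LIMIT LAW `ρ_∞ dV_{T₁}`** (`SU(2)`, `ℰp`, `γ ≥ 0`): under the `∀ ε ∃ depth` hypothesis (any chained
windows, excised steps) the effective densities converge in `L¹(dV_{T₁})` to a probability density `ρ_∞ ≥ 0` and the unit laws converge to
`ρ_∞ dV_{T₁}` uniformly over measurable `|g| ≤ 1`. -/
theorem exists_limitUnitLaw_TV_of_refine_windowTilt_uniformMass {γ : ℝ} (hγ : 0 ≤ γ)
    (h : ∀ ε : ℝ, 0 < ε → ∃ (n K₀ : ℕ) (δ : ℝ)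
      (E : ∀ K, Set (GaugeField ((F.refine n).P K) 0 (Matrix.specialUnitaryGroup (Fin 2) ℂ))) (r : ℕ → ℝ),
      δ ≤ ε ∧ δ < 1 ∧ (∀ K, MeasurableSet (E K)) ∧ Summable r ∧
      (∀ K, K₀ ≤ K → IsTilt
        (Measure.map (unitA (F.refine n) ℰp K)
          ((gibbsK (F.refine n) ℰp (γ * ((F.L : ℝ)⁻¹) ^ n) K).restrict (E K)))
        (Measure.map (unitA (F.refine n) ℰp (K + 1))
          ((gibbsK (F.refine n) ℰp (γ * ((F.L : ℝ)⁻¹) ^ n) (K + 1)).restrict (E (K + 1)))) (r K)) ∧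
      (∀ K, K₀ ≤ K → (gibbsK (F.refine n) ℰp (γ * ((F.L : ℝ)⁻¹) ^ n) K).real (E K)ᶜ ≤ δ)) :
    ∃ ρl : GaugeField (F.P 0) 0 (Matrix.specialUnitaryGroup (Fin 2) ℂ) → ℝ, Measurable ρl ∧ (∀ u, 0 ≤ ρl u) ∧
      Integrable ρl (fieldMeasure (F.P 0) 0 (Matrix.specialUnitaryGroup (Fin 2) ℂ)) ∧
      IsProbabilityMeasure ((fieldMeasure (F.P 0) 0 (Matrix.specialUnitaryGroup (Fin 2) ℂ)).withDensity
        fun u => ENNReal.ofReal (ρl u)) ∧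
      ∀ ε : ℝ, 0 < ε → ∃ J₀ : ℕ, ∀ J : ℕ, J₀ ≤ J →
        ∀ g : GaugeField (F.P 0) 0 (Matrix.specialUnitaryGroup (Fin 2) ℂ) → ℝ, Measurable g → (∀ u, |g u| ≤ 1) →
          |(∫ u, g u ∂F.unitLaw ℰp measurableE_ℰp γ J) -
              ∫ u, g u ∂(fieldMeasure (F.P 0) 0 (Matrix.specialUnitaryGroup (Fin 2) ℂ)).withDensity
                fun u => ENNReal.ofReal (ρl u)| ≤ ε :=
  exists_limitUnitLaw_TV_of_uniformCauchy F hγ fun _ hε =>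
    unitLaw_uniformCauchy_of_refine_windowTilt_uniformMass F ℰp measurableE_ℰp hγ h hε

/-- **THE PATTERN ⇒ (NT3) FOR EVERY HAAR-ATOMLESS LABEL** (`SU(2)`, `ℰp`, `γ ≥ 0`): if the unit-lattice loop variable of `C` has
product-Haar-null level sets then `UniformVariance (F.scheme ℰp γ) C c` for some `c > 0` (a.c. total-variation limit + §1 of `…TVNontrivial`). -/
theorem exists_uniformVariance_of_haarNull_of_pattern {γ : ℝ} (hγ : 0 ≤ γ)
    (h : ∀ ε : ℝ, 0 < ε → ∃ (n K₀ : ℕ) (δ : ℝ)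
      (E : ∀ K, Set (GaugeField ((F.refine n).P K) 0 (Matrix.specialUnitaryGroup (Fin 2) ℂ))) (r : ℕ → ℝ),
      δ ≤ ε ∧ δ < 1 ∧ (∀ K, MeasurableSet (E K)) ∧ Summable r ∧
      (∀ K, K₀ ≤ K → IsTilt
        (Measure.map (unitA (F.refine n) ℰp K)
          ((gibbsK (F.refine n) ℰp (γ * ((F.L : ℝ)⁻¹) ^ n) K).restrict (E K)))
        (Measure.map (unitA (F.refine n) ℰp (K + 1))
          ((gibbsK (F.refine n) ℰp (γ * ((F.L : ℝ)⁻¹) ^ n) (K + 1)).restrict (E (K + 1)))) (r K)) ∧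
      (∀ K, K₀ ≤ K → (gibbsK (F.refine n) ℰp (γ * ((F.L : ℝ)⁻¹) ^ n) K).real (E K)ᶜ ≤ δ))
    (C : ULoop3 F)
    (hC : ∀ t : ℝ, fieldMeasure (F.P 0) 0 (Matrix.specialUnitaryGroup (Fin 2) ℂ) {u | loopAt u (C.1.atLevel 0) = t} = 0) :
    ∃ c : ℝ, UniformVariance (F.scheme ℰp γ) C c := by
  obtain ⟨ρl, _, _, _, hP, hTV⟩ := exists_limitUnitLaw_TV_of_refine_windowTilt_uniformMass F hγ h
  haveI := hP
  obtain ⟨c, hc, hev⟩ := variance_eventually_ge_of_tvLimit (fun J => F.unitLaw ℰp measurableE_ℰp γ J) _ hTV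
    (measurable_loopAt (C.1.atLevel 0)) (fun u => abs_loopAt_le_one u _)
    (fun a => withDensity_absolutelyContinuous _ _ (hC a))
  refine ⟨c, hc, ?_⟩
  filter_upwards [hev] with K hK
  rw [expectAt_eq_integral_unitLaw measurableE_ℰp hγ K, expectAt_eq_integral_unitLaw measurableE_ℰp hγ K]
  simpa [pow_two] using hK

/-- **THE PATTERN ⇒ `ContinuumYM3Torus F ℰp γ ∧ LimitPointsNontrivial (F.scheme ℰp γ)`** (`SU(2)`, `ℰp`, `γ ≥ 0`): existence through total
variation (uniformly Cauchy unit laws), uniqueness / RP / covariance by the node theorems, non-triviality from the plaquette at the origin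
(`T3NontrivialityFromTilt.fieldMeasure_plaqLevel_eq_zero`).  Nothing open is proved here. -/
theorem continuumYM3Torus_nontrivial_of_pattern {γ : ℝ} (hγ : 0 ≤ γ)
    (h : ∀ ε : ℝ, 0 < ε → ∃ (n K₀ : ℕ) (δ : ℝ)
      (E : ∀ K, Set (GaugeField ((F.refine n).P K) 0 (Matrix.specialUnitaryGroup (Fin 2) ℂ))) (r : ℕ → ℝ),
      δ ≤ ε ∧ δ < 1 ∧ (∀ K, MeasurableSet (E K)) ∧ Summable r ∧
      (∀ K, K₀ ≤ K → IsTilt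
        (Measure.map (unitA (F.refine n) ℰp K)
          ((gibbsK (F.refine n) ℰp (γ * ((F.L : ℝ)⁻¹) ^ n) K).restrict (E K)))
        (Measure.map (unitA (F.refine n) ℰp (K + 1))
          ((gibbsK (F.refine n) ℰp (γ * ((F.L : ℝ)⁻¹) ^ n) (K + 1)).restrict (E (K + 1)))) (r K)) ∧
      (∀ K, K₀ ≤ K → (gibbsK (F.refine n) ℰp (γ * ((F.L : ℝ)⁻¹) ^ n) K).real (E K)ᶜ ≤ δ)) :
    ContinuumYM3Torus F ℰp γ ∧ LimitPointsNontrivial (F.scheme ℰp γ) := by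
  have hlim : HasContinuumLimit (F.scheme ℰp γ) :=
    hasContinuumLimit_of_unitLaw_cauchySeq F ℰp measurableE_ℰp hγ fun W hWm hW1 =>
      Metric.cauchySeq_iff.mpr fun ε hε => by
        obtain ⟨J₀, hJ₀⟩ := unitLaw_uniformCauchy_of_refine_windowTilt_uniformMass F ℰp measurableE_ℰp hγ h (half_pos hε)
        exact ⟨J₀, fun J hJ J' hJ' => by
          rw [Real.dist_eq]; exact (hJ₀ J J' hJ hJ' W hWm hW1).trans_lt (half_lt_self hε)⟩
  refine ⟨(continuumYM3Torus_iff_hasContinuumLimit_SU F ℰp measurableE_ℰp hγ).mpr hlim, ?_⟩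
  obtain ⟨c, hc⟩ := exists_uniformVariance_of_haarNull_of_pattern F hγ h (plaquette3 (0 : F.USite) 0 1) fun t => by
    simp_rw [T3NontrivialityFromTilt.loopAt_plaquette3 (0 : F.USite) (show (0 : Fin 3) < 1 by decide)]
    exact T3NontrivialityFromTilt.fieldMeasure_plaqLevel_eq_zero _ t
  exact limitPointsNontrivial_of_uniformVariance hc

end PatternSU2

end Summit.QuantumFields.YangMills.Theorems.WideningTVWindow

end
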